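import Mathlib
import Literature.Analysis.Calculus.ExpDuhamel
import Literature.MathematicalPhysics.QuantumFieldTheory.Sweep1AreaLawProofs
import Literature.MathematicalPhysics.QuantumFieldTheory.Balaban1983to89.B7Prop6Bound

/-!
# `Balaban1983to89.B7Transfer` — B7 Sect. C under an arbitrary covariant average, and the group step (161) ⇒ (162)

CITATION HEADER (lean-in-tree rule 2026-08-18).  Reproduction of the ALGEBRA and ARITHMETIC of
T. Bałaban, *Averaging operations for lattice gauge theories*, Comm. Math. Phys. **98**, 17–51 (1985)
[Balaban1985Averaging] (cell paper B7; `paper:balaban1985-cmp98-averaging`, journal page = PDF page + 16),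
Sect. C pp. 30–33 [(88)–(100)] and Sect. E p. 42 [(161)–(162)], read against the blanket transfer claim of
T. Bałaban, *Renormalization group approach to lattice gauge field theories. I*, Comm. Math. Phys. **109**,
249–301 (1987) [Balaban1987RG1] (cell paper B12), p. 253 (0.5)–(0.11) and p. 254 (0.12): "This average has
properties similar to the properties of the average introduced in (0.4), especially all results of the paper
[12] are valid for it. The proofs are in most cases unchanged; in others only minor and obvious modifications
are needed."  Render-checked 2026-08-18 (`b2b-balaban-ref1/pages/1985-cmp98-averaging/…-p014…p017-x2.png`,
`…-p026-x2.png`; `…/1987-cmp109-rg-I-small-field/…-p005-x2.png`, `…-p006-x2.png`).  Both papers are UNDER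
ADJUDICATION by the audit cell `pub-balaban` (GAPS row G3, TEMPLATE T-G1); nothing of them is asserted here:
every hypothesis below is an explicit binder, and the file proves only group algebra and real/normed-ring
inequalities.  Companion census: `pub-balaban/b2b-balaban-b07/g2/transfer-census-B7-under-B12-average.md`.
v1.1 (unit b07-g3, 2026-08-18): header-only revision for DIVERGENCE D-pv14.8 (PRINTED/READING labels in §§2–3, the
(93)/(88) shorthand of §1, the page of (26), pointers to the sibling modules); every declaration byte-identical.

## §1  What Sect. C of B7 uses of the averaging operation (transfer skeleton)

PRINTED (B7 pp. 31–32; renders `…-p015-x2.png`, `…-p016-x2.png` re-read 2026-08-18 by unit b07-g3 for v1.1).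
(93) p. 32: `(Ṽ₁)_c = (\overline{V₁V₀})_c V̄_{0,−c} = v(c₋)(\widetilde{V₁^{v⁻¹}})_c R̄_{0,c} v⁻¹(c₊)`, `c ⊂ Ω′^{(1)}`
(v1 of this header abbreviated the first member as "`V̄₁ V̄₀⁻¹ = Ṽ₁`"; cf. (88) p. 31
`Ū^k_b(Ū^k_0)_b⁻¹ = … = (\overline{R_{0,b₋}U₁^{(k)}})⁻¹ Ũ^k_1 R̄^k_{0,b} \overline{R_{0,b₊}U₁^{(k)}}` and the definition (89) of
`(\overline{R(V₀)V₁})_c`), i.e. with `v(x) = \overline{R_{0,x}V₁}` and `V̿₁ = \overline{R(V₀)V₁}` ((90), (95)) the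
factorisation `Ṽ₁(c) = v(c₋) V̿₁(c) R̄_{0,c} v⁻¹(c₊)` ((97) at `j = 1`); by induction ((96)–(98)) one gets (92)/(97)
`Ũ₁^j = (Ū₁Ū₀)^j (Ū₀^j)⁻¹ = v_j(b₋) (U̿₁^j)_b R̄^j_{0,b} v_j⁻¹(b₊)`,
`v_j(x) = (\overline{R_{0,x}U₁})(\overline{R̄_{0,x}U̿₁}) ⋯ (\overline{R̄^{j−1}_{0,x}U̿₁^{j−1}})`, the step (98) using ONLY
the covariance (93) `\widetilde{V₁^v} = (Ṽ₁)^v` of the one-step operation under "moving-frame" gauge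
transformations `(V₁^v)_b = v(b₋) V_{1,b} R_{0,b} v⁻¹(b₊)`, and (99)–(100) identify `v_j(y)` with the
recursively defined block averages (85) `\overline{R_{0,y}U₁^{(j)}}`, using the covariance of the transporter
`R̄^j_{0,y}` and the left-invariance `\overline{g·f} = g·\overline{f}` of the site average (78).

CERTIFIED HERE, over an arbitrary group `G` and arbitrary index types (sites `S`, level-`j` bonds `B`,
level-`(j+1)` bonds `C`): `frame` (the moving-frame action), `dbar` (the recipe (89) for an ARBITRARY
site-function recipe `w`), `avg_eq_frame_dbar` ((89) solved = (92) at `k = 1`), `step98` (the induction step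
(98) from the covariance hypothesis `hcov` = (93)), `step99` ((99)–(100) from transporter covariance `hT` and
left-invariance `hb`).  The hypotheses name exactly what the printed proof uses of the average.  For B7's own
average (15)/(41) they are the printed (93) and the holonomy covariance; for B12's average (0.12), built from
the `M`-transporters `U(y,x) = M({U(Γ)}_{Γ∈G(y,x)})` (0.11), they follow from the two-sided covariance axiom
(0.6) `M({uU_jv}) = uM({U_j})v` (B12 p. 253) — this instantiation is ARGUED IN THE CENSUS (§2 there), not in
Lean (the group mean `M` is not formalised).  Nothing here asserts that B12's `M` exists ((0.10), Federbush).

## §2  The group step (161) ⇒ (162) (B7 p. 42; left open by `B7Prop6Bound`, header "NOT certified here")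

PRINTED (p. 42).  (161) `|(1/i) log U̿′^j| = |Q_j(U₀, ηA′)| < 2α₁L^jη`; (162)
`|(1/i) log(\overline{R̄^j_{0,x}U̿′^j})| = |Σ_{x_j∈B(x)} L^{-d} (1/i) log (R̄^j_{0,x}U̿′^j)(Γ_{x,x_j})| < 8α₁dL^{j+1}η e^{2α₁dL^{j+1}η}`
(print continues `< O(1)α₁L^{j+1}η, j = 0, 1, …, k−1` and does not unpack the path product).
READING (the typer's, via (77) p. 30 and (159)–(160) p. 42; not a quotation — DIVERGENCE D-pv14.8):
`(R̄^j_{0,x}U̿′^j)(Γ_{x,x_j}) = ∏_{b∈Γ} R(Ū^j_0(Γ_{x,b₋})) (U̿′^j)_b` is an ordered product of `s ≤ d(L−1)`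
factors `W_b exp(iQ_{j,b}) W_b⁻¹` with `W_b` unitary.

CERTIFIED HERE (normed ring `𝔸`, complete real normed algebra for `exp`): `norm_conj_sub_one_le`
(`‖W X W′ − 1‖ ≤ ‖X − 1‖` for `WW′ = 1`, `‖W‖, ‖W′‖ ≤ 1`), `norm_exp_sub_one_le_of_le`
(`‖exp B − 1‖ ≤ e^β − 1` for `‖B‖ ≤ β`, from the tree's `Literature.Analysis.Calculus.norm_exp_sub_one_le`),
`path_product_sub_one_le` (`‖∏_{i<s} W_i exp(B_i) W′_i − 1‖ ≤ e^{sβ} − 1`), `convex_comb_norm_le` (the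
`L^{-d}`-weighted site average does not increase a uniform bound), and the real arithmetic `ineq162_arith` (with the tree's `AreaLaw.exp_sub_one_le_mul_exp`):
with `s ≤ d(L−1)` and `β = 2α₁L^jη`, `sβ ≤ x := 2dα₁L^{j+1}η` (`path_exponent_le`) and
`2(e^{sβ} − 1) ≤ 2·sβ·e^{sβ} ≤ 4x e^x = 8α₁dL^{j+1}η e^{2α₁dL^{j+1}η}` (`ineq162_of_161` assembles the chain)
(the factor `2` is the printed logarithm bound (26) `|log X| ≤ 2|X − 1|` for `|X − 1| ≤ ½`, whose DOMAIN
condition is `domain26_of_le_third`: `sβ ≤ 1/3 ⇒ e^{sβ} − 1 ≤ ½`, i.e. `2dα₁ ≤ 1/3` once `L^{j+1}η ≤ 1`).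
NOT certified IN THIS FILE: the inequality (26) (p. 22) itself and the identity `exp((1/i)·log X· i) = X`.
Both are kernel theorems of sibling modules landed after v1: `MatrixLog` (unit f1-g4: the series (21) `mlog`,
(26) `norm_mlog_le_two_mul`, `exp_mlog`) and `B7TransferLog` (unit pv14: `ineq162_log_of_161`, the logarithmic
form of this §2, and `ineq162_blockAvg_of_161`, the middle member of (162)); the first equality of (162), with
the carrier (78)/(110) of the block average of site variables and `log ∘ exp = id` on small elements, and the
seam (162) ⇒ (163) into `B7Prop6Bound.ineq163_explicit` are the business of `B7BlockAvgLog` (unit b07-g3).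

## §3  The corner cancellation behind (48) (Prop. 1) for a symmetric family of corner transporters

PRINTED (B7 p. 25 [PDF 9], render `…-p009-x2.png` re-read 2026-08-18 by unit b07-g3): "Denoting by `(p′)_x` a
plaquette obtained by translation of the plaquette `p′` to the point `x`, we have the identity
`Σ_{c⊂∂p′} Σ_{x∈B(c₋)} L^{-d} A(Γ_{c,x}) = Σ_{x∈B(y₀)} L^{-d} A(∂(p′)_x) = Σ_{x∈B(y₀)} L^{-d} Σ_{p⊂(p′)_x} A(∂p)`. (48)"
(no mechanism sentence in print).  READING (the typer's; not a quotation — DIVERGENCE D-pv14.8): in the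
linearisation of `log V̄(∂p′)` the path terms `A(Γ_{c₋,x})` and `−A(Γ_{c₊,x′})` of consecutive sides of `∂p′`
cancel after re-indexing `x′ ↦ x`, leaving the straight-segment and plaquette terms — the reason for the first
equality of (48).  `corner_terms_cancel` is the cyclic telescoping `Σ_i (a_i + t_i − a_{i+1}) = Σ_i t_i`
over `ZMod m`; it applies verbatim when the corner functional `a` is the `G(y,x)`-average
`(1/|G(y,x)|) Σ_{Γ∈G(y,x)} A(Γ)` of B12 (0.4)/(0.8)+(0.11), because the incoming and the outgoing side use the
SAME functional at the shared corner (census §3.1).  [folklore]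
-/

noncomputable section

namespace Literature.MathematicalPhysics.QuantumFieldTheory.Balaban1983to89.B7Transfer

open Finset

/-! ## §1. Sect. C of B7 over an arbitrary covariant one-step average -/

section Covariance

variable {G : Type*} {S B C : Type*}

/-- The block recipe (82)/(85) in abstract form: `w_Y(y) = \overline{x ↦ T_Y(y,x)}(y)`, the site average of the
moving-frame transporters of `Y` from the points `x` of the block to its centre `y`. [folklore] -/
def wOf (T : (B → G) → S → S → G) (bavg : (S → G) → S → G) (Y : B → G) : S → G :=
  fun y => bavg (fun x => T Y y x) y

/-- Unfolding of `wOf`. [folklore] -/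
@[simp] theorem wOf_apply (T : (B → G) → S → S → G) (bavg : (S → G) → S → G) (Y : B → G) (y : S) :
    wOf T bavg Y y = bavg (fun x => T Y y x) y := rfl

variable [Group G]

/-- The moving-frame gauge action of a site function `v` on level-`j` bond variables (B7 (92), (97), (159)):
`(Y^v)_b = v(b₋) · Y_b · ρ_b(v(b₊))⁻¹`, `ρ_b` = conjugation by the background bond variable / transporter of `b`
(`R̄^j_{0,b}` in B7; the `M`-transporter `Ū^j_0(b)` after the transfer to B12 (0.12)). [folklore] -/
def frame (bm bp : B → S) (ρ : B → G →* G) (v : S → G) (Y : B → G) : B → G :=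
  fun b => v (bm b) * Y b * (ρ b (v (bp b)))⁻¹

/-- The one-step "double-bar" recipe (B7 (89)): `Y̿(c) = w_Y(c₋)⁻¹ · (avg Y)(c) · σ_c(w_Y(c₊))`, for an
ARBITRARY site-function recipe `w` (B7: `w_Y(x) = \overline{R̄_{0,x}Y}` of (82)/(85)). [folklore] -/
def dbar (cm cp : C → S) (σ : C → G →* G) (avg : (B → G) → C → G) (w : (B → G) → S → G)
    (Y : B → G) : C → G :=
  fun c => (w Y (cm c))⁻¹ * avg Y c * σ c (w Y (cp c))

/-- Unfolding of `frame`. [folklore] -/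
@[simp] theorem frame_apply (bm bp : B → S) (ρ : B → G →* G) (v : S → G) (Y : B → G) (b : B) :
    frame bm bp ρ v Y b = v (bm b) * Y b * (ρ b (v (bp b)))⁻¹ := rfl

/-- Unfolding of `dbar`. [folklore] -/
@[simp] theorem dbar_apply (cm cp : C → S) (σ : C → G →* G) (avg : (B → G) → C → G)
    (w : (B → G) → S → G) (Y : B → G) (c : C) :
    dbar cm cp σ avg w Y c = (w Y (cm c))⁻¹ * avg Y c * σ c (w Y (cp c)) := rfl

/-- (89) solved for the average, i.e. (92) at `k = 1`: `avg Y = (Y̿)^{w_Y}` — for ANY recipe `w`; no property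
of the average is used. [folklore] -/
theorem avg_eq_frame_dbar (cm cp : C → S) (σ : C → G →* G) (avg : (B → G) → C → G)
    (w : (B → G) → S → G) (Y : B → G) :
    avg Y = frame cm cp σ (w Y) (dbar cm cp σ avg w Y) := by
  funext c
  simp only [frame_apply, dbar_apply]
  group

/-- The induction step (98) of B7 Sect. C.  Hypotheses: the one-step operation `avg` (B7: `Y ↦ (Y·Ū₀^j)‾(Ū₀^{j+1})⁻¹`,
(68)) is COVARIANT under moving-frame gauge transformations — B7 (93); for B12's average (0.12) this is the
axiom (0.6) applied to each `M`-transporter (census §2) — and (97) holds at level `j`: `Ũ^j = (U̿^j)^{v_j}`.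
Conclusion: `Ũ^{j+1} = avg Ũ^j = (U̿^{j+1})^{v_{j+1}}` with `U̿^{j+1} = dbar … U̿^j` and the accumulated frame
`v_{j+1} = v_j · w(U̿^j)` (pointwise product, new factor on the RIGHT as in (97)). [folklore] -/
theorem step98 (bm bp : B → S) (ρ : B → G →* G) (cm cp : C → S) (σ : C → G →* G)
    (avg : (B → G) → C → G)
    (hcov : ∀ (v : S → G) (Y : B → G), avg (frame bm bp ρ v Y) = frame cm cp σ v (avg Y))
    (w : (B → G) → S → G) {v : S → G} {Y Ut : B → G} (h97 : Ut = frame bm bp ρ v Y) :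
    avg Ut = frame cm cp σ (v * w Y) (dbar cm cp σ avg w Y) := by
  subst h97
  rw [hcov]
  funext c
  simp only [frame_apply, dbar_apply, Pi.mul_apply, map_mul, mul_inv_rev]
  group

/-- The identification (99) ⇒ (100) of B7 Sect. C.  Hypotheses: the moving-frame transporter `T_Y(y,x)` (B7:
`(R̄^j_{0,y}Y)(Γ^{(j)}_{y,x})` along the tree contour; B12: the same with the `M`-transporter of (0.11)) is covariant,
`T_{Y^v}(y,x) = v(y) T_Y(y,x) τ_{y,x}(v(x))⁻¹` (`τ_{y,x}` = conjugation by the background transporter), and the site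
average is left-invariant, `\overline{g·f}(y) = g·\overline{f}(y)` (B7 (78)).  If (97) holds at level `j` with frame
`v` (so that, by the induction hypothesis (99), the level-`j` block averages `\overline{R_{0,x}U₁^{(j)}}` equal
`v(x)`), then the level-`(j+1)` block average (85) `\overline{x ↦ T_{Ũ^j}(y,x) τ_{y,x}(v(x))}(y)` equals
`(v · w(U̿^j))(y) = v_{j+1}(y)`, the frame produced by `step98`. [folklore] -/
theorem step99 (bm bp : B → S) (ρ : B → G →* G) (T : (B → G) → S → S → G) (τ : S → S → G →* G)
    (hT : ∀ (v : S → G) (Y : B → G) (y x : S),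
      T (frame bm bp ρ v Y) y x = v y * T Y y x * (τ y x (v x))⁻¹)
    (bavg : (S → G) → S → G)
    (hb : ∀ (g : G) (f : S → G) (y : S), bavg (fun x => g * f x) y = g * bavg f y)
    {v : S → G} {Y Ut : B → G} (h97 : Ut = frame bm bp ρ v Y) (y : S) :
    bavg (fun x => T Ut y x * τ y x (v x)) y = (v * wOf T bavg Y) y := by
  subst h97
  have h : (fun x => T (frame bm bp ρ v Y) y x * τ y x (v x)) = fun x => v y * T Y y x := by
    funext x
    rw [hT]
    group
  rw [h, hb]
  simp only [Pi.mul_apply, wOf_apply]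

/-- The two steps packaged: one level of the induction (96)–(100).  From (97)+(99) at level `j` (encoded as
`Ut = Y^v`) to (97)+(99) at level `j+1` with `U̿^{j+1} = dbar … Y`, `v_{j+1} = v · w_Y`,
`w_Y = wOf T bavg Y`. [folklore] -/
theorem sectC_induction_step (bm bp : B → S) (ρ : B → G →* G) (cm cp : C → S) (σ : C → G →* G)
    (avg : (B → G) → C → G) (T : (B → G) → S → S → G) (τ : S → S → G →* G)
    (bavg : (S → G) → S → G)
    (hcov : ∀ (v : S → G) (Y : B → G), avg (frame bm bp ρ v Y) = frame cm cp σ v (avg Y))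
    (hT : ∀ (v : S → G) (Y : B → G) (y x : S),
      T (frame bm bp ρ v Y) y x = v y * T Y y x * (τ y x (v x))⁻¹)
    (hb : ∀ (g : G) (f : S → G) (y : S), bavg (fun x => g * f x) y = g * bavg f y)
    {v : S → G} {Y Ut : B → G} (h97 : Ut = frame bm bp ρ v Y) :
    avg Ut = frame cm cp σ (v * wOf T bavg Y) (dbar cm cp σ avg (wOf T bavg) Y) ∧
      ∀ y, bavg (fun x => T Ut y x * τ y x (v x)) y = (v * wOf T bavg Y) y :=
  ⟨step98 bm bp ρ cm cp σ avg hcov (wOf T bavg) h97, step99 bm bp ρ T τ hT bavg hb h97⟩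

end Covariance

/-! ## §2. The group step (161) ⇒ (162) -/

section GroupStep

variable {𝔸 : Type*} [NormedRing 𝔸]

/-- A unitary moving frame does not increase the deviation from `1`: `‖W X W′ − 1‖ ≤ ‖X − 1‖` whenever
`W W′ = 1`, `‖W‖ ≤ 1`, `‖W′‖ ≤ 1` (for B7: `W = R(Ū^j_0(Γ_{x,b₋}))` unitary, `W′ = W⁻¹`). [folklore] -/
theorem norm_conj_sub_one_le (W X W' : 𝔸) (hWW' : W * W' = 1) (hW : ‖W‖ ≤ 1) (hW' : ‖W'‖ ≤ 1) :
    ‖W * X * W' - 1‖ ≤ ‖X - 1‖ := by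
  have h : W * X * W' - 1 = W * (X - 1) * W' := by
    rw [mul_sub, sub_mul, mul_one, hWW']
  rw [h]
  calc ‖W * (X - 1) * W'‖ ≤ ‖W * (X - 1)‖ * ‖W'‖ := norm_mul_le _ _
    _ ≤ ‖W * (X - 1)‖ := mul_le_of_le_one_right (norm_nonneg _) hW'
    _ ≤ ‖W‖ * ‖X - 1‖ := norm_mul_le _ _
    _ ≤ ‖X - 1‖ := mul_le_of_le_one_left (norm_nonneg _) hW

variable [NormedAlgebra ℝ 𝔸] [CompleteSpace 𝔸]

open NormedSpace in
/-- `‖exp B − 1‖ ≤ e^β − 1` for `‖B‖ ≤ β` (the factor `(U̿′^j)_b = exp(iQ_{j,b})`, `|Q_{j,b}| < 2α₁L^jη` = (161)).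
From the tree's `Literature.Analysis.Calculus.norm_exp_sub_one_le`. [folklore] -/
theorem norm_exp_sub_one_le_of_le (B : 𝔸) {β : ℝ} (hB : ‖B‖ ≤ β) :
    ‖exp B - 1‖ ≤ Real.exp β - 1 := by
  have h1 := Literature.Analysis.Calculus.norm_exp_sub_one_le B
  have h2 : Real.exp ‖B‖ ≤ Real.exp β := Real.exp_le_exp.mpr hB
  linarith

open NormedSpace B7Prop6Bound in
/-- The path product of (162): if each of the `s` factors is `a_i = W_i exp(B_i) W′_i` with `W_iW′_i = 1`,
`‖W_i‖, ‖W′_i‖ ≤ 1`, `‖B_i‖ ≤ β`, then `‖a_0 ⋯ a_{s−1} − 1‖ ≤ e^{sβ} − 1`. [folklore] -/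
theorem path_product_sub_one_le (W B W' : ℕ → 𝔸) (s : ℕ) {β : ℝ}
    (hWW' : ∀ i < s, W i * W' i = 1) (hW : ∀ i < s, ‖W i‖ ≤ 1) (hW' : ∀ i < s, ‖W' i‖ ≤ 1)
    (hB : ∀ i < s, ‖B i‖ ≤ β) :
    ‖oprod (fun i => W i * exp (B i) * W' i) s - 1‖ ≤ Real.exp (s * β) - 1 := by
  have hfac : ∀ i < s, ‖W i * exp (B i) * W' i - 1‖ ≤ Real.exp β - 1 := fun i hi =>
    (norm_conj_sub_one_le (W i) (exp (B i)) (W' i) (hWW' i hi) (hW i hi) (hW' i hi)).trans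
      (norm_exp_sub_one_le_of_le (B i) (hB i hi))
  have hprod : (∏ i ∈ range s, (1 + ‖W i * exp (B i) * W' i - 1‖)) ≤ ∏ _i ∈ range s, Real.exp β :=
    Finset.prod_le_prod (fun i _ => by positivity) fun i hi => by
      have := hfac i (mem_range.mp hi); linarith
  rw [prod_const, card_range, ← Real.exp_nat_mul] at hprod
  have h0 := prod_sub_one_norm_le (fun i => W i * exp (B i) * W' i) s
  linarith

/-- The `L^{-d}`-weighted site average over `x_j ∈ B(x)` in (162) (and in (0.12)) is a convex combination, so a
uniform bound on the summands passes to the average. [folklore] -/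
theorem convex_comb_norm_le {E : Type*} [SeminormedAddCommGroup E] [NormedSpace ℝ E] {ι : Type*}
    (t : Finset ι) (wt : ι → ℝ) (z : ι → E) {K : ℝ} (hw : ∀ i ∈ t, 0 ≤ wt i) (hsum : ∑ i ∈ t, wt i = 1)
    (hz : ∀ i ∈ t, ‖z i‖ ≤ K) : ‖∑ i ∈ t, wt i • z i‖ ≤ K := by
  calc ‖∑ i ∈ t, wt i • z i‖ ≤ ∑ i ∈ t, ‖wt i • z i‖ := norm_sum_le _ _
    _ = ∑ i ∈ t, wt i * ‖z i‖ := by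
        refine sum_congr rfl fun i hi => ?_
        rw [norm_smul, Real.norm_of_nonneg (hw i hi)]
    _ ≤ ∑ i ∈ t, wt i * K := sum_le_sum fun i hi => mul_le_mul_of_nonneg_left (hz i hi) (hw i hi)
    _ = K := by rw [← sum_mul, hsum, one_mul]

omit [NormedAlgebra ℝ 𝔸] [CompleteSpace 𝔸] in
/-- The domain condition of the logarithm bound (26) (`|X − 1| ≤ ½`): `t ≤ 1/3 ⇒ e^t − 1 ≤ ½`
(via `e^t ≤ 1/(1 − t) ≤ 3/2`).  With `t = sβ ≤ 2dα₁L^{j+1}η ≤ 2dα₁` this is `α₁ ≤ 1/(6d)`. [folklore] -/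
theorem domain26_of_le_third {t : ℝ} (ht : t ≤ 1 / 3) : Real.exp t - 1 ≤ 1 / 2 := by
  have h1 : 1 - t ≤ Real.exp (-t) := by have := Real.add_one_le_exp (-t); linarith
  have hpos : 0 < Real.exp t := Real.exp_pos t
  have h2 : Real.exp (-t) * Real.exp t = 1 := by rw [← Real.exp_add]; simp
  -- (1 - t) e^t ≤ 1, hence e^t ≤ 1/(1-t) ≤ 3/2
  have h3 : (1 - t) * Real.exp t ≤ 1 := by nlinarith [mul_le_mul_of_nonneg_right h1 hpos.le]
  nlinarith

omit [NormedAlgebra ℝ 𝔸] [CompleteSpace 𝔸] in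
/-- The real arithmetic of (162).  With `s ≤ d(L−1)` bonds on the path, `β = 2α₁L^jη` from (161), one has
`sβ ≤ x := 2dα₁L^{j+1}η`; then `2(e^{sβ} − 1) ≤ 2·sβ·e^{sβ} ≤ 2x e^x ≤ 4x e^x = 8α₁dL^{j+1}η·e^{2α₁dL^{j+1}η}`
(the leading `2` is the constant of the printed logarithm bound (26); the print's `8` has a factor `2` to spare).
[folklore] -/
theorem ineq162_arith {t x : ℝ} (ht0 : 0 ≤ t) (htx : t ≤ x) :
    2 * (Real.exp t - 1) ≤ 4 * x * Real.exp x := by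
  have hx : 0 ≤ x := ht0.trans htx
  have h1 : Real.exp t - 1 ≤ t * Real.exp t := AreaLaw.exp_sub_one_le_mul_exp t
  have h2 : t * Real.exp t ≤ x * Real.exp x :=
    mul_le_mul htx (Real.exp_le_exp.mpr htx) (Real.exp_pos t).le hx
  have h3 : 0 ≤ x * Real.exp x := mul_nonneg hx (Real.exp_pos x).le
  linarith

omit [NormedAlgebra ℝ 𝔸] [CompleteSpace 𝔸] in
/-- The bookkeeping `sβ ≤ 2dα₁L^{j+1}η`: `s ≤ d(L − 1)` (number of level-`j` bonds on `Γ_{x,x_j}`, `x_j ∈ B^j(x)`),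
`β = 2α₁ℓ` with `ℓ = L^jη ≥ 0`, `α₁ ≥ 0`, `d ≥ 0`. [folklore] -/
theorem path_exponent_le {s d L α₁ ℓ : ℝ} (hs : s ≤ d * (L - 1)) (hd : 0 ≤ d) (hα : 0 ≤ α₁)
    (hℓ : 0 ≤ ℓ) : s * (2 * α₁ * ℓ) ≤ 2 * d * α₁ * (L * ℓ) := by
  have h1 : s ≤ d * L := by nlinarith
  have h2 : 0 ≤ 2 * α₁ * ℓ := by positivity
  nlinarith [mul_le_mul_of_nonneg_right h1 h2]

open NormedSpace B7Prop6Bound in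
/-- (161) ⇒ (162), assembled modulo the printed logarithm bound (26).  If the path product has `s ≤ d(L−1)`
factors `W_i exp(B_i) W′_i` (`W_iW′_i = 1`, norms `≤ 1`, `‖B_i‖ ≤ 2α₁ℓ`, `ℓ = L^jη`), then
`‖∏ − 1‖ ≤ e^{sβ} − 1`, `2(e^{sβ} − 1) ≤ 8α₁d(Lℓ) e^{2α₁d(Lℓ)}` (the printed right side of (162), `Lℓ = L^{j+1}η`),
and if moreover `2dα₁(Lℓ) ≤ 1/3` the product lies in the domain `‖∏ − 1‖ ≤ ½` of (26). [folklore] -/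
theorem ineq162_of_161 (W B W' : ℕ → 𝔸) (s : ℕ) {d L α₁ ℓ : ℝ}
    (hs : (s : ℝ) ≤ d * (L - 1)) (hd : 0 ≤ d) (hα : 0 ≤ α₁) (hℓ : 0 ≤ ℓ)
    (hWW' : ∀ i < s, W i * W' i = 1) (hW : ∀ i < s, ‖W i‖ ≤ 1) (hW' : ∀ i < s, ‖W' i‖ ≤ 1)
    (hB : ∀ i < s, ‖B i‖ ≤ 2 * α₁ * ℓ) :
    ‖oprod (fun i => W i * exp (B i) * W' i) s - 1‖ ≤ Real.exp (s * (2 * α₁ * ℓ)) - 1 ∧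
    2 * (Real.exp (s * (2 * α₁ * ℓ)) - 1) ≤ 8 * α₁ * d * (L * ℓ) * Real.exp (2 * α₁ * d * (L * ℓ)) ∧
    (2 * d * α₁ * (L * ℓ) ≤ 1 / 3 → ‖oprod (fun i => W i * exp (B i) * W' i) s - 1‖ ≤ 1 / 2) := by
  have hprod := path_product_sub_one_le W B W' s hWW' hW hW' hB
  have ht0 : 0 ≤ (s : ℝ) * (2 * α₁ * ℓ) := by positivity
  have htx : (s : ℝ) * (2 * α₁ * ℓ) ≤ 2 * d * α₁ * (L * ℓ) := path_exponent_le hs hd hα hℓ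
  refine ⟨hprod, ?_, fun hsmall => hprod.trans (domain26_of_le_third (htx.trans hsmall))⟩
  have h := ineq162_arith ht0 htx
  calc 2 * (Real.exp (s * (2 * α₁ * ℓ)) - 1) ≤ 4 * (2 * d * α₁ * (L * ℓ)) * Real.exp (2 * d * α₁ * (L * ℓ)) := h
    _ = 8 * α₁ * d * (L * ℓ) * Real.exp (2 * α₁ * d * (L * ℓ)) := by ring_nf

end GroupStep

/-! ## §3. The corner cancellation of (48) -/

section Corner

/-- Cyclic telescoping: around a closed polygon of `m` sides, corner terms entering with `+` at the start of a
side and with `−` at its end cancel, `Σ_i (a_i + t_i − a_{i+1}) = Σ_i t_i`.  In B7 (48) `a_i` is the block sum of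
the corner path functionals `Σ_x L^{-d} A(Γ_{c_{i,−},x})`; the identity needs only that the SAME functional is used
by the incoming and the outgoing side at each corner — true for the tree contours of B7 (by the reversal
convention) and for the symmetric families `G(y,x)` of B12 (0.4)/(0.11) alike (census §3.1). [folklore] -/
theorem corner_terms_cancel {A : Type*} [AddCommGroup A] {m : ℕ} [NeZero m] (a t : ZMod m → A) :
    ∑ i, (a i + t i - a (i + 1)) = ∑ i, t i := by
  have h : ∑ i : ZMod m, a (i + 1) = ∑ i, a i :=
    Fintype.sum_equiv (Equiv.addRight (1 : ZMod m)) (fun i => a (i + 1)) a fun _ => rfl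
  simp only [Finset.sum_sub_distrib, Finset.sum_add_distrib, h]
  abel

end Corner

end Literature.MathematicalPhysics.QuantumFieldTheory.Balaban1983to89.B7Transfer
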